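import Summits.ABC.IUTFork.ForkGenuineWindowSharpExplicit
import Summits.ABC.IUTFork.LDHGenuinePerImageShallow
import Literature.IUT.LogVolume.GenuineLogThetaPerImageExactVolume
import HarnessLib

/-!
# The fork at [IUTchIII] Corollary 3.12, L-DH level, READING (P): the CONTENTFUL sufficient half — the per-image
# `−|log(Θ)|` realises the different gain `D♯` at EVERY genuine input, so the (P)-line crux holds wherever
# `((l+1)/24 − 1/(2l))·deĝ̲(𝔮) ≤ D♯ + ((l+5)/4)·log π` (abc-iut cell, crux ThetaPartII = stmt-ABC-19678, stub `stub_cor312PerImage`)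

Record-only PROOF file (D-0012) of the abc-iut cell (WAVE-3 discharge seat abc-iut-c312-d1, gen 7; self-proposed row
«P-CRUX-SUFFICIENCY», STATUS 2026-08-26T12:2xZ); TAKES NO SIDE on [IUTchIII] Cor. 3.12 or on the (U)/(P) readings.
Sequel to this seat's `LDHGenuinePerImageShallow` (p438354: the FREE inequality in reading (P),
`−deĝ̲_lgp(P_Θ) ≤ −|log(Θ)|^{nonarch}_(P)`, different gain := 0) and the (P)-twin of abc-iut-w6-d018's
`ForkGenuineWindowSharp.neg_ndegLgpSlotMin_add_dSharp_le_negLogThetaNonarch` (reading (U), slot-minimum) and of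
abc-iut-S4's `ForkGenuineWindowSharpExplicit` (the `min_J d_{L_J}` term bounded; closed form of the gain).

MECHANISM (classical volume algebra on the tree's typed objects). At a summand `v⃗ ∈ V(F₀)_p^{j+1}` the per-image region
of [IUTchIII] Cor. 3.12 Step (x) (p. 181: «one for each possible image») is the (Ind2)-orbit of the LAST-slot twist
`M_P = ι_j(t_{Θ,j,v_j})·(R_I)^∼` (abc-iut-s2-p2 `realPrimePacketWith_slotImages_pilotRegion_eq`); abc-iut-w6-d018's
packet-level SHARP lower end `packetLogμ_packetHull_orbit_ge_sharp` (Dupuy–Hilado §4.9/§4.12; [IUTchIV] Prop. 1.1: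
`log‖g‖ + (d_I − d_{L_J})·log p ≤ log μ̄(hull(⋃_γ γ·M))` for ANY bounded `M ⊇ ι_a(g)·(R_I)^∼`, at every factor field
`L_J` of `⊗_{ℚ_p} K_{v̲_b} ≅ ∏_J L_J`) applies to `M = M_P` itself — the gain needs NO slot union and NO factor
permutation. Summing with Dupuy–Hilado's weights (Def. 3.6.3):

* `neg_thetaLast_add_dSharp_le_logμ_slotImagesHull` — per summand, every factor `J`:
  `−θ_j(v_j) + (d_I(v⃗) − d_{L_J}(v⃗))·log p ≤ log μ̄_{v⃗}(hull of the slot images)`;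
* **`neg_ndegLgp_add_dSharp_le_negLogThetaPerImageNonarch`** — GLOBAL: `−deĝ̲_lgp(P_Θ) + D♯(I) ≤ negLogThetaPerImageNonarch I`
  with w6-d018's `D♯(I) = Σ_{p∈T(I)} (1/ℓ⋇)·Σ_j Σ_{v⃗} (d_I(v⃗) − min_J d_{L_J}(v⃗))·log p·Π_b Pr(v_b)` (spelled inline, the
  SAME expression as in `ForkGenuineWindowSharp`); with abc-iut-S4's bound and closed form ([IUTchIV] Prop. 1.7, (E1)):
  **`neg_ndegLgp_add_closedForm_le_negLogThetaPerImageNonarch`** —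
  `−deĝ̲_lgp(P_Θ) + Σ_{p∈T(I)} (((ℓ⋇+3)/2)·Σ_{u|p} Pr(u)·d(K_{u̲}) − Σ_{u|p} d(K_{u̲}))·log p ≤ −|log(Θ)|^{nonarch}_(P)`;
* **`cor312PerImageOf_of_le_closedForm`** — hence [IUTchIII] Cor. 3.12 IN READING (P) HOLDS at every genuine input with
  `((l+1)/24 − 1/(2l))·deĝ̲(𝔮) ≤ Σ_{p∈T(I)} (((ℓ⋇+3)/2)·Σ_u Pr(u)·d(K_{u̲}) − Σ_u d(K_{u̲}))·log p + ((l+5)/4)·log π`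
  (the shallow regime of p438354 is the case «gain dropped»);
* `closedForm_le_of_hullEstimatePerImageOf` — and the per-image hull estimate (ii′-P) pays the same gain:
  `HullEstimatePerImageOf I δ → Σ_p (((ℓ⋇+3)/2)·Σ_u Pr(u)·d_u − Σ_u d_u)·log p ≤ δ`.

The `λ`-line form in print's currency `log-diff + (1 − 1/l)·log-cond` (abc-iut-S4's `ForkGenuineWindowSharpLogDiff` /
`…Cond`: `K/F_mod` Galois, [IUTchIV] Step (ii)) is the sequel file `LDHGenuinePerImageSufficiencyPoint`. READING (numbers,
statements about OUR typed objects): with this seat's NECESSITY `szpiro_of_cor312PerImageAtDatum_tame_six` (p437841) the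
(P)-line crux per datum is sandwiched between two Szpiro-type inequalities whose constants BOTH tend to `6` as `l → ∞`;
nothing here asserts `Cor312PerImageOf` for any input or the existence of data. [cite: Mochizuki2012, IUTchIII Cor. 3.12
p. 173–174; proof Step (x) p. 181] [cite: Mochizuki2012, IUTchIV Prop. 1.1 p. 9; Thm. 1.10 Step (v) p. 27–29, Step (vii) p. 30]
[cite: DupuyHilado2025, Def. 3.6.3, §3.9, §4.9, §4.12] [claim: Mochizuki2012, status: disputed] for every IUT quotation.
PROOF-ONLY: no definitions, no new `Prop`; typed ≠ proved.
-/

noncomputable section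

open Set Literature.IUT.LogVolume NumberField IsDedekindDomain
open scoped Pointwise

namespace Summit.ABC.IUTFork.GenuineContent

section PerImageWindow

variable {F₀ : Type} [Field F₀] [NumberField F₀] {K : Type} [Field K] [NumberField K] [Algebra F₀ K]
variable (I : ThetaVolumeInput F₀ K)

/-! ## 1. Per summand: the sharp lower end of the PER-IMAGE hull in θ-currency -/

/-- `negLogThetaPerImageLoc p` UNFOLDED at a prime: `(1/ℓ⋇)·Σ_{j=1}^{ℓ⋇} Σ_{v⃗ ∈ V(F₀)_p^{j+1}} log μ̄_{v⃗}(hull of the slot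
images at v⃗)·Π_k Pr(v_k)` over the real packet (Mochizuki normalisation) of the genuine completions — Dupuy–Hilado Def. 3.6.3
read per possible image ([IUTchIII] Step (x)). [cite: DupuyHilado2025, Def. 3.6.3, §4.12]
[cite: Mochizuki2012, IUTchIII Cor. 3.12 proof Step (x) p. 181] -/
theorem negLogThetaPerImageLoc_eq_sum {p : ℕ} [hp : Fact p.Prime] :
    I.negLogThetaPerImageLoc p =
      (1 / (I.X.lstar : ℝ)) * ∑ i : Fin I.X.lstar, ∑ e : Fin ((i : ℕ) + 1 + 1) → placesOver F₀ p,
        (realPrimePacketM p (I.σ.localFieldFamily p hp.out)).logμ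
          ((realPrimePacketM p (I.σ.localFieldFamily p hp.out)).slotImagesHull
            ((realPrimePacketM p (I.σ.localFieldFamily p hp.out)).pilotRegion (I.tΘ p hp.out))
              ((i : ℕ) + 1) e) * ∏ b, weight F₀ (e b).1 := by
  rw [I.negLogThetaPerImageLoc_of_prime hp.out]
  rfl

/-- **Sharp lower end per summand of the PER-IMAGE hull, EVERY factor field**:
`−θ_j(v_j) + (d_I(v⃗) − d_{L_J}(v⃗))·log p ≤ log μ̄_{v⃗}(hull of the slot images)` — the slot images at `v⃗` are the
(Ind2)-orbit of the last-slot twist `ι_j(t_{Θ,j,v_j})·(R_I)^∼` (abc-iut-s2-p2), a bounded region containing itself, so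
abc-iut-w6-d018's `packetLogμ_packetHull_orbit_ge_sharp` applies with NO slot union.
[cite: DupuyHilado2025, §3.9, §4.9, §4.12] [cite: Mochizuki2012, IUTchIV Prop. 1.1 p. 9] -/
theorem neg_thetaLast_add_dSharp_le_logμ_slotImagesHull {p : ℕ} [hp : Fact p.Prime] (i : Fin I.X.lstar)
    (e : Fin ((i : ℕ) + 1 + 1) → placesOver F₀ p)
    (J : DIdx p (fun b => (I.σ.localFieldFamily p hp.out).k (e b))) :
    -(I.X.thetaPilot i (e (Fin.last _)).1 * logNorm F₀ (e (Fin.last _)).1 / localDegree F₀ (e (Fin.last _)).1)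
        + (dSum p (fun b => (I.σ.localFieldFamily p hp.out).k (e b))
            - differentOrd p (DFac p (fun b => (I.σ.localFieldFamily p hp.out).k (e b)) J)) * Real.log p ≤
      (realPrimePacketM p (I.σ.localFieldFamily p hp.out)).logμ
        ((realPrimePacketM p (I.σ.localFieldFamily p hp.out)).slotImagesHull
          ((realPrimePacketM p (I.σ.localFieldFamily p hp.out)).pilotRegion (I.tΘ p hp.out))
            ((i : ℕ) + 1) e) := by
  have hw := packetLogμ_packetHull_orbit_ge_sharp p (fun b => (I.σ.localFieldFamily p hp.out).k (e b))
    (isPsiBounded_smul_normalizedPacket p (fun b => (I.σ.localFieldFamily p hp.out).k (e b))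
      (iota p (fun b => (I.σ.localFieldFamily p hp.out).k (e b)) (Fin.last _)
        (I.tΘ p hp.out i (e (Fin.last _)) : (I.σ.localFieldFamily p hp.out).k (e (Fin.last _)))))
    (I.tΘ p hp.out i (e (Fin.last _))).ne_zero subset_rfl J
  have heq : (realPrimePacketM p (I.σ.localFieldFamily p hp.out)).slotImagesHull
        ((realPrimePacketM p (I.σ.localFieldFamily p hp.out)).pilotRegion (I.tΘ p hp.out)) ((i : ℕ) + 1) e =
      packetHull p (fun b => (I.σ.localFieldFamily p hp.out).k (e b))
        (⋃ γ : indTwo p (fun b => (I.σ.localFieldFamily p hp.out).k (e b)),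
          γ • (iota p (fun b => (I.σ.localFieldFamily p hp.out).k (e b)) (Fin.last _)
            (I.tΘ p hp.out i (e (Fin.last _)) : (I.σ.localFieldFamily p hp.out).k (e (Fin.last _))) •
            (normalizedPacket p (fun b => (I.σ.localFieldFamily p hp.out).k (e b)) :
              Set (PacketAlgebra p (fun b => (I.σ.localFieldFamily p hp.out).k (e b)))))) := by
    show packetHull p (fun b => (I.σ.localFieldFamily p hp.out).k (e b))
        ((realPrimePacketWith p (I.σ.localFieldFamily p hp.out) (mScale p _) (mScale_ne_zero p _) (mScale_perm p _)).slotImages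
          ((realPrimePacketWith p (I.σ.localFieldFamily p hp.out) (mScale p _) (mScale_ne_zero p _)
            (mScale_perm p _)).pilotRegion (I.tΘ p hp.out)) ((i : ℕ) + 1) e) = _
    rw [realPrimePacketWith_slotImages_pilotRegion_eq]
  show _ ≤ packetLogμ p (fun b => (I.σ.localFieldFamily p hp.out).k (e b))
    ((realPrimePacketM p (I.σ.localFieldFamily p hp.out)).slotImagesHull
      ((realPrimePacketM p (I.σ.localFieldFamily p hp.out)).pilotRegion (I.tΘ p hp.out)) ((i : ℕ) + 1) e)
  rw [heq, ← log_norm_tΘ I i (e (Fin.last _))]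
  exact hw

/-- **Sharp lower end per summand of the per-image hull, least factor different**:
`−θ_j(v_j) + (d_I(v⃗) − min_J d_{L_J}(v⃗))·log p ≤ log μ̄_{v⃗}(hull of the slot images)`.
[cite: DupuyHilado2025, §4.9, §4.12] [cite: Mochizuki2012, IUTchIV Prop. 1.1 p. 9] -/
theorem neg_thetaLast_add_dSharpInf_le_logμ_slotImagesHull {p : ℕ} [hp : Fact p.Prime] (i : Fin I.X.lstar)
    (e : Fin ((i : ℕ) + 1 + 1) → placesOver F₀ p) :
    -(I.X.thetaPilot i (e (Fin.last _)).1 * logNorm F₀ (e (Fin.last _)).1 / localDegree F₀ (e (Fin.last _)).1)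
        + (dSum p (fun b => (I.σ.localFieldFamily p hp.out).k (e b))
            - (Finset.univ : Finset (DIdx p (fun b => (I.σ.localFieldFamily p hp.out).k (e b)))).inf'
                Finset.univ_nonempty
                (fun J => differentOrd p (DFac p (fun b => (I.σ.localFieldFamily p hp.out).k (e b)) J)))
          * Real.log p ≤
      (realPrimePacketM p (I.σ.localFieldFamily p hp.out)).logμ
        ((realPrimePacketM p (I.σ.localFieldFamily p hp.out)).slotImagesHull
          ((realPrimePacketM p (I.σ.localFieldFamily p hp.out)).pilotRegion (I.tΘ p hp.out))
            ((i : ℕ) + 1) e) := by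
  obtain ⟨J₀, -, hJ₀⟩ := Finset.exists_mem_eq_inf' (Finset.univ_nonempty : (Finset.univ :
    Finset (DIdx p (fun b => (I.σ.localFieldFamily p hp.out).k (e b)))).Nonempty)
    (fun J => differentOrd p (DFac p (fun b => (I.σ.localFieldFamily p hp.out).k (e b)) J))
  rw [hJ₀]
  exact neg_thetaLast_add_dSharp_le_logμ_slotImagesHull I i e J₀

/-! ## 2. The GLOBAL sharp lower end of `−|log(Θ)|_(P)` -/

/-- **GLOBAL SHARP LOWER END IN READING (P)**: `−ndegLgpOn(P_Θ; T(I)) + D♯(I) ≤ negLogThetaPerImageNonarch I` with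
abc-iut-w6-d018's sharp different gain `D♯(I) := Σ_{p∈T(I)} (1/ℓ⋇)·Σ_j Σ_{v⃗} (d_I(v⃗) − min_J d_{L_J}(v⃗))·log p·Π_b Pr(v_b)`
(spelled inline, the same expression as in `ForkGenuineWindowSharp`) — the last-slot aggregate (abc-iut-S8's `ndegLgpOn`),
NOT the slot minimum: reading (P) pays no (Ind1) slot residue. Unconditional. [cite: DupuyHilado2025, Def. 3.6.3, §4.12]
[cite: Mochizuki2012, IUTchIII Cor. 3.12 proof Step (x) p. 181; IUTchIV Prop. 1.1 p. 9] -/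
theorem neg_ndegLgpOn_add_dSharp_le_negLogThetaPerImageNonarch :
    -I.X.ndegLgpOn I.supportPrimes
        + ∑ p ∈ I.supportPrimes, (1 / (I.X.lstar : ℝ)) * ∑ i : Fin I.X.lstar,
            ∑ e : Fin ((i : ℕ) + 1 + 1) → placesOver F₀ p,
              (if hp : p.Prime then
                haveI : Fact p.Prime := ⟨hp⟩
                (dSum p (fun b => (I.σ.localFieldFamily p hp).k (e b))
                  - (Finset.univ : Finset (DIdx p (fun b => (I.σ.localFieldFamily p hp).k (e b)))).inf'
                      Finset.univ_nonempty
                      (fun J => differentOrd p (DFac p (fun b => (I.σ.localFieldFamily p hp).k (e b)) J)))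
                  * Real.log p
               else 0) * ∏ b, weight F₀ (e b).1 ≤
      I.negLogThetaPerImageNonarch := by
  unfold ThetaVolumeInput.negLogThetaPerImageNonarch PilotData.ndegLgpOn
  rw [← Finset.sum_neg_distrib, ← Finset.sum_add_distrib]
  refine Finset.sum_le_sum fun p hpT => ?_
  have hp' : p.Prime := I.prime_of_mem_supportPrimes hpT
  haveI hp : Fact p.Prime := ⟨hp'⟩
  simp only [dif_pos hp']
  rw [negLogThetaPerImageLoc_eq_sum, ← mul_neg, ← mul_add, ← Finset.sum_neg_distrib, ← Finset.sum_add_distrib]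
  refine mul_le_mul_of_nonneg_left (Finset.sum_le_sum fun i _ => ?_) (one_div_lstar_nonneg I)
  rw [← Finset.sum_neg_distrib, ← Finset.sum_add_distrib]
  refine Finset.sum_le_sum fun e _ => ?_
  rw [← neg_mul, ← add_mul]
  refine mul_le_mul_of_nonneg_right ?_ (prod_weight_nonneg e)
  simp only [PilotData.slotValue]
  exact neg_thetaLast_add_dSharpInf_le_logμ_slotImagesHull I i e

/-- **`−deĝ̲_lgp(P_Θ) + D♯(I) ≤ −|log(Θ)|^{nonarch}_(P)`** — the free inequality of reading (P) (this seat's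
`DHData.free_inequality_perImage_input`, p438354) SHARPENED by the different gain: the last-slot aggregate over `T(I)` is
`deĝ̲_lgp(P_Θ)` (Dupuy–Hilado Thm. 3.10.1, abc-iut-S8's `DHData.ndegLgpOn_eq_ndegLgp`).
[cite: DupuyHilado2025, Thm. 3.10.1, §4.12] [cite: Mochizuki2012, IUTchIII Cor. 3.12 proof Step (x) p. 181] -/
theorem neg_ndegLgp_add_dSharp_le_negLogThetaPerImageNonarch :
    -LgpDivisor.ndegLgp I.X.thetaPilot
        + ∑ p ∈ I.supportPrimes, (1 / (I.X.lstar : ℝ)) * ∑ i : Fin I.X.lstar,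
            ∑ e : Fin ((i : ℕ) + 1 + 1) → placesOver F₀ p,
              (if hp : p.Prime then
                haveI : Fact p.Prime := ⟨hp⟩
                (dSum p (fun b => (I.σ.localFieldFamily p hp).k (e b))
                  - (Finset.univ : Finset (DIdx p (fun b => (I.σ.localFieldFamily p hp).k (e b)))).inf'
                      Finset.univ_nonempty
                      (fun J => differentOrd p (DFac p (fun b => (I.σ.localFieldFamily p hp).k (e b)) J)))
                  * Real.log p
               else 0) * ∏ b, weight F₀ (e b).1 ≤
      I.negLogThetaPerImageNonarch := by
  have h2 : I.X.ndegLgpOn I.supportPrimes = LgpDivisor.ndegLgp I.X.thetaPilot :=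
    (DHData.ofInput I).ndegLgpOn_eq_ndegLgp
  rw [← h2]
  exact neg_ndegLgpOn_add_dSharp_le_negLogThetaPerImageNonarch I

/-- **`−deĝ̲_lgp(P_Θ) + D_expl(I) ≤ −|log(Θ)|^{nonarch}_(P)`** with abc-iut-S4's explicit gain
`D_expl(I) = Σ_{p∈T(I)} (1/ℓ⋇)·Σ_j Σ_{v⃗} (d_I(v⃗) − Σ_{u|p} d(K_{u̲}))·log p·Π_b Pr(v_b)` (`min_J d_{L_J}(v⃗) ≤ Σ_{u|p} d(K_{u̲})`
at every collection, `dExplicitTerm_le_dSharpTerm`). [cite: Mochizuki2012, IUTchIV Prop. 1.1 p. 9] [cite: DupuyHilado2025, §4.12] -/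
theorem neg_ndegLgp_add_dExplicit_le_negLogThetaPerImageNonarch :
    -LgpDivisor.ndegLgp I.X.thetaPilot
        + ∑ p ∈ I.supportPrimes, (1 / (I.X.lstar : ℝ)) * ∑ i : Fin I.X.lstar,
            ∑ e : Fin ((i : ℕ) + 1 + 1) → placesOver F₀ p,
              (if hp : p.Prime then
                haveI : Fact p.Prime := ⟨hp⟩
                (dSum p (fun b => (I.σ.localFieldFamily p hp).k (e b))
                  - dSum p (fun u : placesOver F₀ p => (I.σ.localFieldFamily p hp).k u)) * Real.log p
               else 0) * ∏ b, weight F₀ (e b).1 ≤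
      I.negLogThetaPerImageNonarch := by
  refine le_trans ?_ (neg_ndegLgp_add_dSharp_le_negLogThetaPerImageNonarch I)
  refine add_le_add le_rfl (Finset.sum_le_sum fun p hpT => ?_)
  have hp' : p.Prime := I.prime_of_mem_supportPrimes hpT
  haveI hp : Fact p.Prime := ⟨hp'⟩
  refine mul_le_mul_of_nonneg_left (Finset.sum_le_sum fun i _ => Finset.sum_le_sum fun e _ => ?_)
    (one_div_lstar_nonneg I)
  refine mul_le_mul_of_nonneg_right ?_ (prod_weight_nonneg e)
  simp only [dif_pos hp']
  exact mul_le_mul_of_nonneg_right (dExplicitTerm_le_dSharpTerm I i e)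
    (Real.log_nonneg (by exact_mod_cast hp'.one_lt.le))

/-- **`−deĝ̲_lgp(P_Θ) + Σ_{p∈T(I)} (((ℓ⋇+3)/2)·Σ_{u|p} Pr(u)·d(K_{u̲}) − Σ_{u|p} d(K_{u̲}))·log p ≤ −|log(Θ)|^{nonarch}_(P)`** —
the CLOSED FORM (abc-iut-S4's `dExplicit_eq_closedForm`: [IUTchIV] Prop. 1.7 weighted averages, (E1) procession average
`(1/ℓ⋇)·Σ_{j=1}^{ℓ⋇}(j+1) = (ℓ⋇+3)/2 = (l+5)/4`): in reading (P) the genuine hull volume realises the `((l+5)/4)·log(𝔡^K_{v_ℚ})`-shaped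
term that Thm. 1.10 Step (v) ALLOCATES, up to one unweighted different per prime and place.
[cite: Mochizuki2012, IUTchIV Thm. 1.10 Step (i) (E1) p. 23, Step (v) p. 27–29] [cite: DupuyHilado2025, §4.12] -/
theorem neg_ndegLgp_add_closedForm_le_negLogThetaPerImageNonarch :
    -LgpDivisor.ndegLgp I.X.thetaPilot
        + ∑ p ∈ I.supportPrimes,
            (if hp : p.Prime then
              haveI : Fact p.Prime := ⟨hp⟩
              ((((I.X.lstar : ℝ) + 3) / 2) *
                  ∑ u : placesOver F₀ p, weight F₀ u.1 * differentOrd p ((I.σ.localFieldFamily p hp).k u)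
                - dSum p (fun u : placesOver F₀ p => (I.σ.localFieldFamily p hp).k u)) * Real.log p
             else 0) ≤
      I.negLogThetaPerImageNonarch := by
  rw [← dExplicit_eq_closedForm I]
  exact neg_ndegLgp_add_dExplicit_le_negLogThetaPerImageNonarch I

/-! ## 3. Consequences for the (P)-line: Cor. 3.12 (P) where the gap is below the gain; (ii′-P) pays the gain -/

/-- **[IUTchIII] Cor. 3.12 IN READING (P) HOLDS at every genuine input whose gap is below the different gain**:
if `((l+1)/24 − 1/(2l))·deĝ̲(𝔮) ≤ Σ_{p∈T(I)} (((ℓ⋇+3)/2)·Σ_{u|p} Pr(u)·d(K_{u̲}) − Σ_{u|p} d(K_{u̲}))·log p + ((l+5)/4)·log π`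
then `Cor312PerImageOf I` (`−deĝ̲(P_q) = −(1/2l)·deĝ̲(𝔮)`, `deĝ̲_lgp(P_Θ) = ((l+1)/24)·deĝ̲(𝔮)`, the closed-form lower end, the
archimedean summand). The shallow regime `cor312PerImageOf_of_shallow` (p438354) is the case with the gain dropped. A kernel
theorem about the tree's typed numbers; no side taken on the disputed claim for ALL initial Θ-data.
[cite: Mochizuki2012, IUTchIII Cor. 3.12 p. 173–174; proof Step (x) p. 181] [cite: Mochizuki2012, IUTchIV Thm. 1.10 Step (vii) p. 30] -/
theorem cor312PerImageOf_of_le_closedForm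
    (h : (((I.X.l : ℝ) + 1) / 24 - 1 / (2 * (I.X.l : ℝ))) * FinDivisor.ndeg F₀ I.X.qDivisor ≤
      ∑ p ∈ I.supportPrimes,
            (if hp : p.Prime then
              haveI : Fact p.Prime := ⟨hp⟩
              ((((I.X.lstar : ℝ) + 3) / 2) *
                  ∑ u : placesOver F₀ p, weight F₀ u.1 * differentOrd p ((I.σ.localFieldFamily p hp).k u)
                - dSum p (fun u : placesOver F₀ p => (I.σ.localFieldFamily p hp).k u)) * Real.log p
             else 0)
        + ThetaVolumeInput.archLogTheta I.l) :
    I.Cor312PerImageOf := by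
  have hlow := neg_ndegLgp_add_closedForm_le_negLogThetaPerImageNonarch I
  rw [DHData.ndegLgp_thetaPilot_eq] at hlow
  have hq := I.negAbsLogQ_eq
  unfold ThetaVolumeInput.Cor312PerImageOf ThetaVolumeInput.negLogThetaPerImage
  rw [hq]
  have hsplit : (((I.X.l : ℝ) + 1) / 24 - 1 / (2 * (I.X.l : ℝ))) * FinDivisor.ndeg F₀ I.X.qDivisor =
      ((I.X.l : ℝ) + 1) / 24 * FinDivisor.ndeg F₀ I.X.qDivisor
        - 1 / (2 * (I.X.l : ℝ)) * FinDivisor.ndeg F₀ I.X.qDivisor := sub_mul _ _ _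
  change -(1 / (2 * (I.X.l : ℝ))) * FinDivisor.ndeg F₀ I.X.qDivisor ≤
    I.negLogThetaPerImageNonarch + ThetaVolumeInput.archLogTheta I.X.l
  change _ ≤ _ + ThetaVolumeInput.archLogTheta I.X.l at h
  linarith

/-- **The per-image hull estimate (ii′-P) pays the different gain**: `HullEstimatePerImageOf I δ →
Σ_{p∈T(I)} (((ℓ⋇+3)/2)·Σ_{u|p} Pr(u)·d(K_{u̲}) − Σ_{u|p} d(K_{u̲}))·log p ≤ δ` — the (P)-twin of abc-iut-S4's
`slotResidue_add_closedForm_le_of_hullEstimateOf` WITHOUT the slot residue: on the per-image line only the different gain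
is owed. Nothing asserted about any input. [cite: Mochizuki2012, IUTchIV Thm. 1.10 Steps (v)–(viii) p. 27–30]
[cite: DupuyHilado2025, §4.12] -/
theorem closedForm_le_of_hullEstimatePerImageOf {δ : ℝ} (h : I.HullEstimatePerImageOf δ) :
    ∑ p ∈ I.supportPrimes,
        (if hp : p.Prime then
          haveI : Fact p.Prime := ⟨hp⟩
          ((((I.X.lstar : ℝ) + 3) / 2) *
              ∑ u : placesOver F₀ p, weight F₀ u.1 * differentOrd p ((I.σ.localFieldFamily p hp).k u)
            - dSum p (fun u : placesOver F₀ p => (I.σ.localFieldFamily p hp).k u)) * Real.log p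
         else 0) ≤ δ := by
  have hlow := neg_ndegLgp_add_closedForm_le_negLogThetaPerImageNonarch I
  unfold ThetaVolumeInput.HullEstimatePerImageOf at h
  linarith

end PerImageWindow

end Summit.ABC.IUTFork.GenuineContent

end
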